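import Mathlib
import HarnessLib
/-!
# HodgeLocusCensusScrollRowsN — the (n,4) 'α' cells δ = [Z] − [Π], n = 4, 6, 8: dimension bookkeeping of the degree-3 scroll loci (cell pub-hlocus, referee gen 15, REFEREE.md R29 (g))
HONEST FRAMING: certified instances and evidence bearing on the general Hodge conjecture; no claim.

For the Fermat quartic n-fold, Z = cone_Λ(E) (Aoki–Shioda CI(2,2,1^{n/2−1})) and Π = cone_Λ(L) share the vertex Λ = V(x₀,…,x₃) ∩ V(ℓ_j), and
E ∼ L + C on the Fermat K3 (HodgeLocusCensusScrollRows.lean) gives δ = [Z] − [Π] = [cone_Λ(C)], a degree-3 rational normal scroll of dimension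
k = n/2 spanning a ℙ^{k+2} — the flat limit S(0,…,0,3) of the generic degree-3 k-fold scroll: S(1,2) ⊂ ℙ⁴ (k = 2), ℙ¹ × ℙ² ⊂ ℙ⁵ (k = 3), the cone over
ℙ¹ × ℙ² in ℙ⁶ (k = 4). Engine R (`ref_as_scroll_n.py`, two primes, `data/ivhs/census/refg15/ref_as_scroll_n.json`) certifies I_{cone C}(4) ⊆ ker M_δ
(λ = −1; the λ = +1 control fails) and generic finiteness of the scroll incidence with ranks 114 / 291 / 626, equal to dim S₄ − rank M_δ = 126 − 12,
330 − 39, 715 − 89 (B = R ranks). Kernel-checked here is the arithmetic of that equality: the family dimension (k+3)(k−1) + inner(k) with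
inner = 24 − 6, 35 − 11, 6 + (35 − 11); h⁰(𝒪_S(4)) = 35, 5·15, Σ_{j≤4}(j+1)·C(j+2,2) = 140; h⁰(I_S(4)) = C(n+5,4) − h⁰(𝒪_S(4)).
-/
namespace Summit.HodgeConjecture.HodgeConjecture.HodgeLocus.Census.Scroll

/-- dimension of the family of degree-3 k-fold scrolls in ℙ^{2k+1}: Grassmannian of ℙ^{k+2} ⊂ ℙ^{2k+1} plus the orbit dimension inside ℙ^{k+2}. -/
def scrollFamilyDim (k : ℕ) : ℕ :=
  (k + 3) * (k - 1) + (if k = 2 then 24 - 6 else if k = 3 then 35 - 11 else 6 + (35 - 11))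

/-- h⁰(𝒪_S(4)) for the generic degree-3 k-fold scroll (k = 2: RR on 𝔽₁; k = 3: 𝒪(4,4) on ℙ¹×ℙ²; k = 4: cone, cumulative). -/
def h0OS4 (k : ℕ) : ℕ :=
  if k = 2 then 35 else if k = 3 then 5 * 15 else ((List.range 5).map fun j => (j + 1) * Nat.choose (j + 2) 2).sum

/-- the B = R first-order ranks of δ = [Z] − [Π] at λ = −1 in the cells (4,4), (6,4), (8,4). -/
def rankMdelta (k : ℕ) : ℕ := if k = 2 then 12 else if k = 3 then 39 else 89

/-- scroll family dim + h⁰(I_S(4)) = dim S₄ − rank M_δ in all three cells: 23 + 91 = 114, 36 + 255 = 291, 51 + 575 = 626. -/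
theorem scroll_dimension_equality :
    ∀ k ∈ [2, 3, 4],
      scrollFamilyDim k + (Nat.choose (2 * k + 5) 4 - h0OS4 k) = Nat.choose (2 * k + 5) 4 - rankMdelta k := by
  decide

/-- the three measured incidence ranks and the certified dimensions, as numbers. -/
theorem scroll_numbers :
    scrollFamilyDim 2 = 23 ∧ scrollFamilyDim 3 = 36 ∧ scrollFamilyDim 4 = 51 ∧
    h0OS4 2 = 35 ∧ h0OS4 3 = 75 ∧ h0OS4 4 = 140 ∧
    Nat.choose 9 4 - 35 = 91 ∧ Nat.choose 11 4 - 75 = 255 ∧ Nat.choose 13 4 - 140 = 575 ∧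
    23 + 91 = 114 ∧ 36 + 255 = 291 ∧ 51 + 575 = 626 := by decide

end Summit.HodgeConjecture.HodgeConjecture.HodgeLocus.Census.Scroll
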